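import Literature.Geometry.Hyperkaehler.HolomorphicSymplecticLefschetzDecomposition
import Literature.Geometry.Hyperkaehler.HolomorphicHardLefschetzBidegrees
import HarnessLib

/-!
# Fujiki's holomorphic Lefschetz decomposition in all bidegrees
# (Huybrechts 1999 §1.7 after Fujiki 1987: `H^q(X, Ω^p) = ⊕_ℓ L_σ^{p-ℓ} H^q(X, Ω^{2ℓ-p})_σ`, `H^q(Ω^p)_σ = ker L_σ^{n-p+1}`)

Layer `Literature/Geometry/Hyperkaehler`, namespace `Literature.Geometry.Hyperkaehler`; lane `lit-hodgefound`
(Track 2 foundations library, Layer A), p06's self-proposed row g12-#5 of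
`run/shared/lean/pub/lit-hodgefound/SKELETON.md` («(g12-#2 `HolomorphicSymplecticLefschetzDecomposition`: `q = 0`)⁺ ·
(g12-#3 `HolomorphicHardLefschetzBidegrees`)⁺ — Fujiki's holomorphic Lefschetz DECOMPOSITION in all bidegrees»).
Sequel of `HolomorphicSymplecticLefschetzDecomposition.lean` (row g12-#2: the bundled operator
`lefschetzPowC Ω i h = Ω^{∧i} ∧ ·`, the `σ`-primitive `(k,0)`-forms and Lange's decomposition
`Λ^{k,0} = ⊕ᵢ σ^{∧i} ∧ P^{k-2i}_σ` — the case `q = 0` of the present file, whose proofs are followed line by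
line) and of `HolomorphicHardLefschetzBidegrees.lean` (row g12-#3: `σ^{∧j} ∧ ·` is injective on `Λ^{p,q}` for
`p + j ≤ r` and bijective `Λ^{p,q} ⥲ Λ^{2r-p,q}` for `p + j = r`, every `q`). THREE DATA DEFINITIONS WITH BODIES
(`primitiveFormsPQ`, `lefschetzSummandPQ` — `ℂ`-subspaces of `Altᵏ_ℝ(E; ℂ)`) and THEOREMS; no named fact
(net debt `0`).

## Source, verbatim (held copy)

D. Huybrechts, *Compact hyperkähler manifolds: basic results*, Invent. Math. **135** (1999) 63–113, §1.7 (held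
`paper:arxiv-alg-geom_9705025`, p0004 L29–L50): "**Fujiki also proved holomorphic versions of the Lefschetz
decomposition and the Hard Lefschetz Theorem.** They allow one to compute other cohomology groups of the form
`H^q(X, Ω^p_X)` as follows: Let `L_σ : H^q(X, Ω^p_X) → H^q(X, Ω^{p+2}_X)` and
`L_σ̄ : H^q(X, Ω^p_X) → H^{q+2}(X, Ω^p_X)` be the map given by the cup-product with `σ` and `σ̄`, respectively,
and let **`H^q(X, Ω^p_X)_σ := ker(L_σ^{n-p+1})`** and `H^q(X, Ω^p_X)_σ̄ := ker(L_σ̄^{n-q+1})`. Then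
**`H^q(X, Ω^p_X) = ⊕_{(p-ℓ) ≥ (p-n)^+} L_σ^{p-ℓ} H^q(X, Ω^{2ℓ-p}_X)_σ`**
`= ⊕_{(q-ℓ) ≥ (q-n)^+} L_σ̄^{q-ℓ} H^{2ℓ-q}(X, Ω^p_X)_σ̄` and `L_σ^{n-p} : H^q(X, Ω^p_X) ≅ H^q(X, Ω^{2n-p}_X)`
for `p ≤ n` […]." (`X` irreducible symplectic of dimension `2n`; the original is A. Fujiki, *On the de Rham
cohomology group of a compact Kähler symplectic manifold*, Adv. Stud. Pure Math. **10** (1987) 105–165,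
Huybrechts' [Fujiki2].) Read POINTWISE (on a tangent space) and on the invariant forms of a complex torus
(`H^q(X, Ω^p_X) ≅ Λ^{p,q}`, row A1-09), for `p ≤ n`, with `i = p - ℓ`: `Λ^{p,q} = ⊕_{i ≥ 0} σ^{∧i} ∧ P^{p-2i, q}_σ`,
`P^{m,q}_σ = Λ^{m,q} ∩ ker σ^{∧(n-m+1)}` — Lange 2023 §7.3.2 (3) "`⋀ᵏV = Pᵏ ⊕ L P^{k-2} ⊕ L² P^{k-4} ⊕ ⋯`"
tensored with `Λ^{0,q}` (Lange Thm. 1.1.21 (b): `H^q(Ω^p) ≅ ⋀ᵖΩ ⊗ ⋀^qΩ̄`).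

## Dictionary

`E` finite-dimensional complex normed space, `dim_ℂ E = 2r` (`r` is Huybrechts' `n`); `σ ∈ Alt²_ℝ(E; ℂ)` of
type `(2,0)` (`IsOfTypeAt 2 0 σ`) and non-degenerate; `Λ^{p,q} = typeSubmodule E k p q` (`p + q = k`);
`L_σ^i = lefschetzPowC σ i h : Alt^n → Alt^k` (`2i + n = k`, row g12-#2). The `σ̄`-decomposition (second
displayed equality) is the complex conjugate of the first and is not restated here.

## Contents (2 data definitions with bodies, theorems; no named fact)

* §1 `lefschetzPowC` on bidegrees: `isOfTypeAt_lefschetzPowC_pq`, `lefschetzPowC_mem_typeSubmodule_pq`,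
  `map_lefschetzPowC_typeSubmodule_pq_le` (`L^i Λ^{m,q} ⊆ Λ^{2i+m,q}`), **`lefschetzPowC_injOn_typeSubmodule_pq`**
  (`L^i` injective on `Λ^{m,q}` for `m + i ≤ r`, from row g12-#3).
* §2 **`primitiveFormsPQ σ k p q = P^{p,q}_σ := {ψ ∈ Λ^{p,q} ∣ σ^{∧(r-p+1)} ∧ ψ = 0}`** (Huybrechts'
  `H^q(Ω^p)_σ = ker L_σ^{n-p+1}`), `mem_primitiveFormsPQ_iff(_of_add_eq)`, `primitiveFormsPQ_le_typeSubmodule`,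
  `primitiveFormsPQ_eq_typeSubmodule_of_le_one` (`P^{p,q} = Λ^{p,q}` for `p ≤ 1`).
* §3 the first step `Λ^{p,q} = P^{p,q}_σ ⊕ σ ∧ Λ^{p-2,q}` (`2 ≤ p ≤ r`, every `q`):
  **`exists_mem_primitiveFormsPQ_add_lefschetzPowC`**, **`disjoint_primitiveFormsPQ_map_lefschetzPowC`**,
  **`primitiveFormsPQ_sup_map_lefschetzPowC`**, `eq_of_primitivePQ_add_lefschetzPowC_eq`.
* §4 `finiteDimensional_primitiveFormsPQ`, **`finrank_primitiveFormsPQ_add`**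
  (`dim P^{p,q}_σ + C(2r, p-2)C(2r, q) = C(2r, p)C(2r, q)`), `finrank_primitiveFormsPQ_of_le_one`.
* §5 **`lefschetzSummandPQ σ k q i = σ^{∧i} ∧ P^{p-2i,q}_σ`**, `lefschetzSummandPQ_eq/_eq_bot/_zero/_one_add/
  _le_typeSubmodule`, **`iSup_lefschetzSummandPQ_eq_typeSubmodule`**, **`iSupIndep_lefschetzSummandPQ`**,
  **`iSupIndep_and_iSup_lefschetzSummandPQ`** — HUYBRECHTS' FIRST DISPLAYED DECOMPOSITION, POINTWISE:
  `Λ^{p,q} = ⊕ᵢ σ^{∧i} ∧ P^{p-2i,q}_σ` for `p ≤ r` and every `q`.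
* §6 (`IsLinearHyperkaehler`, `ComplexTorus`) `σ = ω_J + iω_K` (row Q1043) and the invariant `(p,q)`-forms of the
  holomorphic-symplectic torus `X = E/Φ(ℤ^ι)` (Dolbeault representatives, row A1-09).

## References

* [Huybrechts1999] D. Huybrechts, *Compact hyperkähler manifolds: basic results*, Invent. Math. 135 (1999), §1.7.
* A. Fujiki, Adv. Stud. Pure Math. 10 (1987), 105–165 (Huybrechts' [Fujiki2]; cited as printed there).
* [Lange2023AbelianVarietiesComplex] H. Lange, *Abelian Varieties over the Complex Numbers* (2023), §1.1.5
  Thm. 1.1.21 (b); §7.3.2 (3).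
* [Voisin2002] C. Voisin, *Hodge Theory and Complex Algebraic Geometry I* (2002), Prop. 6.22 (the `sl₂` proof
  of the Lefschetz decomposition).
-/

noncomputable section

set_option maxSynthPendingDepth 3

open scoped ComplexConjugate Manifold
open Module Function Complex Finset
open Literature.Analysis.Complex (IsOfTypeAt typeSubmodule finrank_typeSubmodule)
open Literature.Geometry.Kaehler.ComplexTorus (wedgePow wedgePow_zero wedgePow_succ ofRealForm
  wedge_domDomCongr_finCongr domDomCongr_finCongr_wedge wedgePow_wedge_wedgePow_wedge)
open Literature.Geometry.Kaehler (domDomCongr_finCongr_trans domDomCongr_finCongr_self)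

namespace Literature.Geometry.Hyperkaehler

namespace HolomorphicSymplectic

/-! ## §1 The operator `Lⁱ = σ^{∧i} ∧ ·` on the bidegrees `(m, q)` -/

section Operator

variable {E : Type*} [NormedAddCommGroup E] [NormedSpace ℂ E] {σ : E [⋀^Fin 2]→L[ℝ] ℂ}

/-- Reindexing preserves the pointwise type. [folklore] -/
private theorem isOfTypeAt_domDomCongr_finCongr_iff'' {n n' p q : ℕ} (h : n = n')
    (η : E [⋀^Fin n]→L[ℝ] ℂ) : IsOfTypeAt p q (η.domDomCongr (finCongr h)) ↔ IsOfTypeAt p q η := by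
  subst h; exact Iff.rfl

/-- A reindexed form vanishes only if the form does. [folklore] -/
private theorem eq_zero_of_domDomCongr_finCongr_eq_zero {n n' : ℕ} (h : n = n')
    {α : E [⋀^Fin n]→L[ℝ] ℂ} (h0 : α.domDomCongr (finCongr h) = 0) : α = 0 := by
  subst h; exact h0

/-- **`Lⁱ` maps `Λ^{m,q}` to `Λ^{2i+m,q}`** (the wedge product is bigraded; `σ^{∧i}` has type `(2i,0)`).
[cite: Huybrechts1999, §1.7 (arXiv p. 4)] -/
theorem isOfTypeAt_lefschetzPowC_pq (hσ : IsOfTypeAt 2 0 σ) (i : ℕ) {n k m q : ℕ} (h : 2 * i + n = k)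
    {ψ : E [⋀^Fin n]→L[ℝ] ℂ} (hψ : IsOfTypeAt m q ψ) :
    IsOfTypeAt (2 * i + m) q (lefschetzPowC σ i h ψ) := by
  rw [lefschetzPowC_apply, isOfTypeAt_domDomCongr_finCongr_iff'']
  exact isOfTypeAt_wedgePow_wedge_pq hσ i hψ

/-- Membership form: `Lⁱ(Λ^{m,q}) ⊆ Λ^{2i+m,q}`. [cite: Huybrechts1999, §1.7 (arXiv p. 4)] -/
theorem lefschetzPowC_mem_typeSubmodule_pq (hσ : IsOfTypeAt 2 0 σ) (i : ℕ) {n k m q : ℕ} (h : 2 * i + n = k)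
    (hmq : m + q = n) {ψ : E [⋀^Fin n]→L[ℝ] ℂ} (hψ : ψ ∈ typeSubmodule E n m q) :
    lefschetzPowC σ i h ψ ∈ typeSubmodule E k (2 * i + m) q :=
  (isOfTypeAt_lefschetzPowC_pq hσ i h
    (Literature.Analysis.Complex.isOfTypeAt_of_mem_typeSubmodule hmq hψ)).mem_typeSubmodule

/-- `Lⁱ` maps the submodule `Λ^{m,q}` into `Λ^{2i+m,q}`. [cite: Huybrechts1999, §1.7 (arXiv p. 4)] -/
theorem map_lefschetzPowC_typeSubmodule_pq_le (hσ : IsOfTypeAt 2 0 σ) (i : ℕ) {n k m q : ℕ}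
    (h : 2 * i + n = k) (hmq : m + q = n) :
    Submodule.map (lefschetzPowC σ i h) (typeSubmodule E n m q) ≤ typeSubmodule E k (2 * i + m) q := by
  rintro _ ⟨ψ, hψ, rfl⟩
  exact lefschetzPowC_mem_typeSubmodule_pq hσ i h hmq hψ

variable [FiniteDimensional ℂ E]

/-- **`Lⁱ` is injective on `Λ^{m,q}` below the middle: `m + i ≤ r`**, `dim_ℂ E = 2r`, for EVERY `q` (row
g12-#3's `eq_zero_of_wedgePow_wedge_eq_zero_of_isOfTypeAt`). [cite: Huybrechts1999, §1.7 (arXiv p. 4)] -/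
theorem lefschetzPowC_injOn_typeSubmodule_pq (hσ : IsOfTypeAt 2 0 σ)
    (hnd : ∀ v : E, v ≠ 0 → ∃ w : E, σ ![v, w] ≠ 0) {r i n k m q : ℕ} (hr : 2 * r = finrank ℂ E)
    (h : 2 * i + n = k) (hmq : m + q = n) (hmi : m + i ≤ r) :
    Set.InjOn (lefschetzPowC σ i h) (typeSubmodule E n m q) := by
  intro ψ hψ ψ' hψ' hψψ'
  have hψt := Literature.Analysis.Complex.isOfTypeAt_of_mem_typeSubmodule hmq hψ
  have hψ't := Literature.Analysis.Complex.isOfTypeAt_of_mem_typeSubmodule hmq hψ'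
  have h0 : (wedgePow σ i).wedge (ψ - ψ') = 0 := by
    have h1 : lefschetzPowC σ i h (ψ - ψ') = 0 := by rw [map_sub, hψψ', sub_self]
    rw [lefschetzPowC_apply] at h1
    exact eq_zero_of_domDomCongr_finCongr_eq_zero h h1
  exact sub_eq_zero.1 (eq_zero_of_wedgePow_wedge_eq_zero_of_isOfTypeAt hσ hnd hr hmi (hψt.sub hψ't) h0)

end Operator

/-! ## §2 The `σ`-primitive `(p,q)`-forms `P^{p,q}_σ = Λ^{p,q} ∩ ker σ^{∧(r-p+1)}` -/

section Primitive

variable {E : Type*} [NormedAddCommGroup E] [NormedSpace ℂ E]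

/-- **The `σ`-primitive `(p,q)`-forms `P^{p,q}_σ := ker (L_σ^{r-p+1} : Λ^{p,q} → Λ^{2r-p+2,q})`**,
`r = dim_ℂ E / 2` (Huybrechts 1999 §1.7: "`H^q(X, Ω^p_X)_σ := ker(L_σ^{n-p+1})`"), as a `ℂ`-subspace of
`Altᵏ_ℝ(E; ℂ)` (`k` the total degree, `= p + q` on the meaningful range; for `p > r` the exponent `r - p + 1`
is read in `ℕ`). [cite: Huybrechts1999, §1.7 (arXiv p. 4)] -/
def primitiveFormsPQ (σ : E [⋀^Fin 2]→L[ℝ] ℂ) (k p q : ℕ) : Submodule ℂ (E [⋀^Fin k]→L[ℝ] ℂ) where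
  carrier := {ψ | ψ ∈ typeSubmodule E k p q ∧ (wedgePow σ (finrank ℂ E / 2 - p + 1)).wedge ψ = 0}
  add_mem' {a b} ha hb := by
    refine ⟨Submodule.add_mem _ ha.1 hb.1, ?_⟩
    rw [ContinuousAlternatingMap.wedge_add_right, ha.2, hb.2, add_zero]
  zero_mem' := ⟨Submodule.zero_mem _, ContinuousAlternatingMap.wedge_zero _⟩
  smul_mem' c ψ h := by
    refine ⟨Submodule.smul_mem _ c h.1, ?_⟩
    rw [Literature.NumberTheory.Transcendental.wedge_smul_right_complex, h.2, smul_zero]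

/-- Membership in `P^{p,q}_σ`: type `(p,q)` and `σ^{∧(r-p+1)} ∧ ψ = 0`. [cite: Huybrechts1999, §1.7 (arXiv p. 4)] -/
theorem mem_primitiveFormsPQ_iff (σ : E [⋀^Fin 2]→L[ℝ] ℂ) {k p q : ℕ} (ψ : E [⋀^Fin k]→L[ℝ] ℂ) :
    ψ ∈ primitiveFormsPQ σ k p q ↔
      ψ ∈ typeSubmodule E k p q ∧ (wedgePow σ (finrank ℂ E / 2 - p + 1)).wedge ψ = 0 :=
  Iff.rfl

/-- `P^{p,q}_σ ⊆ Λ^{p,q}`. [cite: Huybrechts1999, §1.7 (arXiv p. 4)] -/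
theorem primitiveFormsPQ_le_typeSubmodule (σ : E [⋀^Fin 2]→L[ℝ] ℂ) (k p q : ℕ) :
    primitiveFormsPQ σ k p q ≤ typeSubmodule E k p q := fun _ h ↦ h.1

/-- Membership with the exponent written additively: if `2r = dim_ℂ E` and `p + j = r` then
`ψ ∈ P^{p,q}_σ ↔ ψ ∈ Λ^{p,q} ∧ σ^{∧(j+1)} ∧ ψ = 0`. [cite: Huybrechts1999, §1.7 (arXiv p. 4)] -/
theorem mem_primitiveFormsPQ_iff_of_add_eq (σ : E [⋀^Fin 2]→L[ℝ] ℂ) {r k p q j : ℕ}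
    (hr : 2 * r = finrank ℂ E) (hpj : p + j = r) (ψ : E [⋀^Fin k]→L[ℝ] ℂ) :
    ψ ∈ primitiveFormsPQ σ k p q ↔ ψ ∈ typeSubmodule E k p q ∧ (wedgePow σ (j + 1)).wedge ψ = 0 := by
  have he : finrank ℂ E / 2 - p + 1 = j + 1 := by omega
  rw [mem_primitiveFormsPQ_iff, he]

/-- The zero-th row is row g12-#2's `(k,0)`-primitive space: `P^{k,0}_σ = primitiveFormsC σ k`.
[cite: Huybrechts1999, §1.7 (arXiv p. 4)] -/
theorem primitiveFormsPQ_zero_eq_primitiveFormsC (σ : E [⋀^Fin 2]→L[ℝ] ℂ) (k : ℕ) :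
    primitiveFormsPQ σ k k 0 = primitiveFormsC σ k := by
  ext ψ
  rw [mem_primitiveFormsPQ_iff, mem_primitiveFormsC_iff]

/-- **`P^{p,q}_σ = Λ^{p,q}` for `p ≤ 1`** (the target `Λ^{2r-p+2, q}` of `L^{r-p+1}` is zero, its first type
index exceeding `dim_ℂ E = 2r`). [cite: Huybrechts1999, §1.7 (arXiv p. 4)] -/
theorem primitiveFormsPQ_eq_typeSubmodule_of_le_one [FiniteDimensional ℂ E] {σ : E [⋀^Fin 2]→L[ℝ] ℂ}
    (hσ : IsOfTypeAt 2 0 σ) {r k p q : ℕ} (hr : 2 * r = finrank ℂ E) (hpq : p + q = k) (hp : p ≤ 1) :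
    primitiveFormsPQ σ k p q = typeSubmodule E k p q := by
  refine le_antisymm (primitiveFormsPQ_le_typeSubmodule σ k p q) fun ψ hψ ↦ ⟨hψ, ?_⟩
  have ht := isOfTypeAt_wedgePow_wedge_pq hσ (finrank ℂ E / 2 - p + 1)
    (Literature.Analysis.Complex.isOfTypeAt_of_mem_typeSubmodule hpq hψ)
  exact ht.eq_zero_of_finrank_lt_fst (by omega)

end Primitive

/-! ## §3 The first step `Λ^{p,q} = P^{p,q}_σ ⊕ σ ∧ Λ^{p-2,q}` (`2 ≤ p ≤ r`, every `q`) -/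

section Decomposition

variable {E : Type*} [NormedAddCommGroup E] [NormedSpace ℂ E] [FiniteDimensional ℂ E]
  {σ : E [⋀^Fin 2]→L[ℝ] ℂ} (hσ : IsOfTypeAt 2 0 σ) (hnd : ∀ v : E, v ≠ 0 → ∃ w : E, σ ![v, w] ≠ 0)
  {r : ℕ} (hr : 2 * r = finrank ℂ E)

include hσ hnd hr

/-- **Existence of the first step in bidegree `(p,q)`, `p = m + 2 ≤ r`**: every `α ∈ Λ^{p,q}` is a
`σ`-primitive form plus `σ ∧ β` with `β ∈ Λ^{m,q}` — `β` from the SURJECTIVITY `σ^{∧(r-m)} : Λ^{m,q} ⥲ Λ^{2r-m,q}`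
of row g12-#3 applied to `σ^{∧(r-p+1)} ∧ α` (Voisin's proof of Prop. 6.22 verbatim, one bidegree at a time).
[cite: Huybrechts1999, §1.7 (arXiv p. 4)] [cite: Voisin2002, Prop. 6.22] -/
theorem exists_mem_primitiveFormsPQ_add_lefschetzPowC {m q k : ℕ} (h : 2 * 1 + (m + q) = k) (hk : m + 2 ≤ r)
    {α : E [⋀^Fin k]→L[ℝ] ℂ} (hα : α ∈ typeSubmodule E k (m + 2) q) :
    ∃ α₀ ∈ primitiveFormsPQ σ k (m + 2) q, ∃ β ∈ typeSubmodule E (m + q) m q,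
      α = α₀ + lefschetzPowC σ 1 h β := by
  obtain ⟨j, hj⟩ := Nat.exists_eq_add_of_le hk
  have hαt := Literature.Analysis.Complex.isOfTypeAt_of_mem_typeSubmodule (by omega) hα
  -- `β ∈ Λ^{m,q}` with `L^{j+2} β = L^{j+1} α` (surjectivity from `Λ^{m,q}`, `m + (j+2) = r`)
  have hLα : IsOfTypeAt (2 * (j + 1 + 1) + m) q
      (lefschetzPowC σ (j + 1) (show 2 * (j + 1) + k = 2 * (j + 1 + 1) + (m + q) by omega) α) := by
    have := isOfTypeAt_lefschetzPowC_pq hσ (j + 1)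
      (show 2 * (j + 1) + k = 2 * (j + 1 + 1) + (m + q) by omega) hαt
    exact ⟨by have := this.1; omega, by
      have h2 : 2 * (j + 1) + (m + 2) = 2 * (j + 1 + 1) + m := by ring
      rw [← h2]; exact this.2⟩
  obtain ⟨β, ⟨hβt, hβ⟩, -⟩ := existsUnique_wedgePow_wedge_eq_pq hσ hnd (p := m) (q := q) (j := j + 1 + 1)
    rfl (by omega) hLα
  refine ⟨α - lefschetzPowC σ 1 h β, ?_, β, hβt.mem_typeSubmodule, (sub_add_cancel _ _).symm⟩
  refine (mem_primitiveFormsPQ_iff_of_add_eq σ hr (show m + 2 + j = r by omega) _).2 ⟨?_, ?_⟩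
  · exact Submodule.sub_mem _ hα (by
      have := lefschetzPowC_mem_typeSubmodule_pq hσ 1 h rfl hβt.mem_typeSubmodule
      simpa only [show 2 * 1 + m = m + 2 by ring] using this)
  · rw [wedgePow_wedge_eq_lefschetzPowC, map_sub, sub_eq_zero, lefschetzPowC_lefschetzPowC]
    change _ = lefschetzPowC σ (j + 1 + 1) _ β
    rw [lefschetzPowC_apply σ (j + 1 + 1), hβ, lefschetzPowC_apply, lefschetzPowC_apply]
    simp only [domDomCongr_finCongr_trans]

/-- **Uniqueness of the first step: `P^{p,q}_σ ∩ σ ∧ Λ^{p-2,q} = 0`** for `p ≤ r` (injectivity below the middle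
in bidegree `(p-2, q)`). [cite: Huybrechts1999, §1.7 (arXiv p. 4)] [cite: Voisin2002, Prop. 6.22] -/
theorem disjoint_primitiveFormsPQ_map_lefschetzPowC {m q k : ℕ} (h : 2 * 1 + (m + q) = k) (hk : m + 2 ≤ r) :
    Disjoint (primitiveFormsPQ σ k (m + 2) q)
      (Submodule.map (lefschetzPowC σ 1 h) (typeSubmodule E (m + q) m q)) := by
  obtain ⟨j, hj⟩ := Nat.exists_eq_add_of_le hk
  rw [Submodule.disjoint_def]
  rintro _ hγ ⟨β, hβ, rfl⟩
  rw [mem_primitiveFormsPQ_iff_of_add_eq σ hr (show m + 2 + j = r by omega), wedgePow_wedge_eq_lefschetzPowC,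
    lefschetzPowC_lefschetzPowC] at hγ
  have hβ0 : β = 0 := by
    have hinj := lefschetzPowC_injOn_typeSubmodule_pq hσ hnd hr (i := j + 1 + 1) (n := m + q) (m := m) (q := q)
      (k := 2 * (j + 1) + k) (by omega) rfl (by omega)
    refine hinj hβ (Submodule.zero_mem _) ?_
    rw [map_zero]
    exact hγ.2
  rw [hβ0, map_zero]

/-- **The first step: `Λ^{p,q} = P^{p,q}_σ ⊔ σ ∧ Λ^{p-2,q}` for `2 ≤ p ≤ r`** — with
`disjoint_primitiveFormsPQ_map_lefschetzPowC` an internal direct sum of `ℂ`-subspaces of `Altᵏ_ℝ(E; ℂ)`.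
[cite: Huybrechts1999, §1.7 (arXiv p. 4)] [cite: Voisin2002, Prop. 6.22] -/
theorem primitiveFormsPQ_sup_map_lefschetzPowC {m q k : ℕ} (h : 2 * 1 + (m + q) = k) (hk : m + 2 ≤ r) :
    primitiveFormsPQ σ k (m + 2) q ⊔ Submodule.map (lefschetzPowC σ 1 h) (typeSubmodule E (m + q) m q) =
      typeSubmodule E k (m + 2) q := by
  refine le_antisymm (sup_le (primitiveFormsPQ_le_typeSubmodule σ k (m + 2) q) ?_) fun α hα ↦ ?_
  · have := map_lefschetzPowC_typeSubmodule_pq_le hσ 1 h (rfl : m + q = m + q)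
    simpa only [show 2 * 1 + m = m + 2 by ring] using this
  · obtain ⟨α₀, hα₀, β, hβ, hαeq⟩ := exists_mem_primitiveFormsPQ_add_lefschetzPowC hσ hnd hr h hk hα
    exact Submodule.mem_sup.2 ⟨α₀, hα₀, _, ⟨β, hβ, rfl⟩, hαeq.symm⟩

/-- **Uniqueness of the decomposition `α = α₀ + σ ∧ β`** (`α₀ ∈ P^{p,q}_σ`, `β ∈ Λ^{p-2,q}`, `2 ≤ p ≤ r`).
[cite: Huybrechts1999, §1.7 (arXiv p. 4)] [cite: Voisin2002, Prop. 6.22] -/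
theorem eq_of_primitivePQ_add_lefschetzPowC_eq {m q k : ℕ} (h : 2 * 1 + (m + q) = k) (hk : m + 2 ≤ r)
    {α₀ α₀' : E [⋀^Fin k]→L[ℝ] ℂ} (hα₀ : α₀ ∈ primitiveFormsPQ σ k (m + 2) q)
    (hα₀' : α₀' ∈ primitiveFormsPQ σ k (m + 2) q) {β β' : E [⋀^Fin (m + q)]→L[ℝ] ℂ}
    (hβ : β ∈ typeSubmodule E (m + q) m q) (hβ' : β' ∈ typeSubmodule E (m + q) m q)
    (heq : α₀ + lefschetzPowC σ 1 h β = α₀' + lefschetzPowC σ 1 h β') : α₀ = α₀' ∧ β = β' := by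
  have hd := disjoint_primitiveFormsPQ_map_lefschetzPowC hσ hnd hr h hk
  have h1 : α₀ - α₀' = lefschetzPowC σ 1 h (β' - β) := by
    rw [map_sub]
    exact sub_eq_sub_iff_add_eq_add.2 (by rw [heq, add_comm])
  have hmem₁ : α₀ - α₀' ∈ primitiveFormsPQ σ k (m + 2) q := Submodule.sub_mem _ hα₀ hα₀'
  have hmem₂ : α₀ - α₀' ∈ Submodule.map (lefschetzPowC σ 1 h) (typeSubmodule E (m + q) m q) :=
    ⟨β' - β, Submodule.sub_mem _ hβ' hβ, h1.symm⟩
  have hzero : α₀ - α₀' = 0 := (Submodule.disjoint_def.1 hd) _ hmem₁ hmem₂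
  refine ⟨sub_eq_zero.1 hzero, ?_⟩
  have hL : lefschetzPowC σ 1 h (β' - β) = 0 := by rw [← h1, hzero]
  have hinj := lefschetzPowC_injOn_typeSubmodule_pq hσ hnd hr (i := 1) (n := m + q) (m := m) (q := q)
    (k := k) h rfl (by omega)
  have := hinj (Submodule.sub_mem _ hβ' hβ) (Submodule.zero_mem _) (by rw [hL, map_zero])
  exact (sub_eq_zero.1 this).symm

end Decomposition

/-! ## §4 Dimensions: `dim P^{p,q}_σ = (C(2r, p) − C(2r, p−2)) C(2r, q)` -/

section Dimension

variable {E : Type*} [NormedAddCommGroup E] [NormedSpace ℂ E] [FiniteDimensional ℂ E]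
  {σ : E [⋀^Fin 2]→L[ℝ] ℂ}

/-- `P^{p,q}_σ` is finite-dimensional. [cite: Huybrechts1999, §1.7 (arXiv p. 4)] -/
theorem finiteDimensional_primitiveFormsPQ (σ : E [⋀^Fin 2]→L[ℝ] ℂ) {k p q : ℕ} (hpq : p + q = k) :
    FiniteDimensional ℂ (primitiveFormsPQ σ k p q) := by
  haveI := finiteDimensional_typeSubmodule_pq (E := E) hpq
  exact Submodule.finiteDimensional_of_le (primitiveFormsPQ_le_typeSubmodule σ k p q)

/-- **`dim_ℂ P^{p,q}_σ + C(2r, p−2) C(2r, q) = C(2r, p) C(2r, q)` for `2 ≤ p ≤ r`** (`dim_ℂ E = 2r`): from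
`Λ^{p,q} = P^{p,q}_σ ⊕ L Λ^{p-2,q}`, the injectivity of `L` below the middle and `dim Λ^{p,q} = C(2r,p)C(2r,q)`
(tree `finrank_typeSubmodule`). [cite: Huybrechts1999, §1.7 (arXiv p. 4)] -/
theorem finrank_primitiveFormsPQ_add (hσ : IsOfTypeAt 2 0 σ)
    (hnd : ∀ v : E, v ≠ 0 → ∃ w : E, σ ![v, w] ≠ 0) {r m q k : ℕ} (hr : 2 * r = finrank ℂ E)
    (h : 2 * 1 + (m + q) = k) (hk : m + 2 ≤ r) :
    finrank ℂ (primitiveFormsPQ σ k (m + 2) q) + (2 * r).choose m * (2 * r).choose q =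
      (2 * r).choose (m + 2) * (2 * r).choose q := by
  have hpq : m + 2 + q = k := by omega
  haveI := finiteDimensional_typeSubmodule_pq (E := E) hpq
  haveI := finiteDimensional_typeSubmodule_pq (E := E) (rfl : m + q = m + q)
  haveI := finiteDimensional_primitiveFormsPQ σ hpq
  set M := Submodule.map (lefschetzPowC σ 1 h) (typeSubmodule E (m + q) m q) with hM
  have hMle : M ≤ typeSubmodule E k (m + 2) q := by
    have := map_lefschetzPowC_typeSubmodule_pq_le hσ 1 h (rfl : m + q = m + q)
    simpa only [show 2 * 1 + m = m + 2 by ring] using this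
  haveI : FiniteDimensional ℂ M := Submodule.finiteDimensional_of_le hMle
  -- `dim M = dim Λ^{m,q}` by injectivity of `L` on `Λ^{m,q}`
  have hinj := lefschetzPowC_injOn_typeSubmodule_pq hσ hnd hr (i := 1) (n := m + q) (m := m) (q := q)
    (k := k) h rfl (by omega)
  have hMdim : finrank ℂ M = finrank ℂ (typeSubmodule E (m + q) m q) := by
    have hinj' : Function.Injective ((lefschetzPowC σ 1 h).domRestrict (typeSubmodule E (m + q) m q)) := by
      intro x y hxy
      apply Subtype.ext
      exact hinj x.2 y.2 (by simpa using hxy)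
    have hrange : LinearMap.range ((lefschetzPowC σ 1 h).domRestrict (typeSubmodule E (m + q) m q)) = M := by
      rw [hM, LinearMap.range_domRestrict]
    rw [← hrange]
    exact LinearMap.finrank_range_of_inj hinj'
  have hsum := Submodule.finrank_sup_add_finrank_inf_eq (primitiveFormsPQ σ k (m + 2) q) M
  rw [(disjoint_primitiveFormsPQ_map_lefschetzPowC hσ hnd hr h hk).eq_bot, finrank_bot, add_zero,
    primitiveFormsPQ_sup_map_lefschetzPowC hσ hnd hr h hk, finrank_typeSubmodule (E := E) hpq, ← hr] at hsum
  rw [hMdim, finrank_typeSubmodule (E := E) (rfl : m + q = m + q), ← hr] at hsum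
  exact hsum.symm

/-- `dim P^{p,q}_σ = C(2r, p) C(2r, q)` for `p ≤ 1` (`P^{p,q}_σ = Λ^{p,q}`). [cite: Huybrechts1999, §1.7 (arXiv p. 4)] -/
theorem finrank_primitiveFormsPQ_of_le_one (hσ : IsOfTypeAt 2 0 σ) {r k p q : ℕ} (hr : 2 * r = finrank ℂ E)
    (hpq : p + q = k) (hp : p ≤ 1) :
    finrank ℂ (primitiveFormsPQ σ k p q) = (2 * r).choose p * (2 * r).choose q := by
  rw [primitiveFormsPQ_eq_typeSubmodule_of_le_one hσ hr hpq hp, finrank_typeSubmodule (E := E) hpq, ← hr]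

end Dimension

/-! ## §5 The full decomposition `Λ^{p,q} = ⊕ᵢ σ^{∧i} ∧ P^{p-2i,q}_σ` (`p ≤ r`, every `q`) -/

section Iterated

variable {E : Type*} [NormedAddCommGroup E] [NormedSpace ℂ E] {σ : E [⋀^Fin 2]→L[ℝ] ℂ}

/-- **The `i`-th holomorphic Lefschetz summand `Lⁱ P^{p-2i,q}_σ ⊂ Λ^{p,q}`** (Huybrechts 1999 §1.7:
"`H^q(X, Ω^p_X) = ⊕ L_σ^{p-ℓ} H^q(X, Ω^{2ℓ-p}_X)_σ`", with `i = p - ℓ`), as a `ℂ`-subspace of `Altᵏ_ℝ(E; ℂ)`: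
the image under `Lⁱ` of `P^{m,q}_σ ⊂ Alt^{m+q}` for the degree `m` with `2i + (m + q) = k` (a supremum over
that — at most one — `m`; it is `0` when `2i + q > k`). [cite: Huybrechts1999, §1.7 (arXiv p. 4)] -/
def lefschetzSummandPQ (σ : E [⋀^Fin 2]→L[ℝ] ℂ) (k q i : ℕ) : Submodule ℂ (E [⋀^Fin k]→L[ℝ] ℂ) :=
  ⨆ (m : ℕ) (h : 2 * i + (m + q) = k), (primitiveFormsPQ σ (m + q) m q).map (lefschetzPowC σ i h)

/-- The summand in terms of the degree `m` with `2i + (m + q) = k`: `Lⁱ P^{m,q}_σ`. [cite: Huybrechts1999, §1.7 (arXiv p. 4)] -/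
theorem lefschetzSummandPQ_eq (σ : E [⋀^Fin 2]→L[ℝ] ℂ) {k q i m : ℕ} (h : 2 * i + (m + q) = k) :
    lefschetzSummandPQ σ k q i = (primitiveFormsPQ σ (m + q) m q).map (lefschetzPowC σ i h) := by
  refine le_antisymm (iSup_le fun m' ↦ iSup_le fun h' ↦ ?_) (le_iSup₂_of_le m h le_rfl)
  obtain rfl : m' = m := by omega
  exact le_rfl

/-- Beyond half the holomorphic degree the summands vanish: `lefschetzSummandPQ σ k q i = 0` for
`2i + q > k`. [cite: Huybrechts1999, §1.7 (arXiv p. 4)] -/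
theorem lefschetzSummandPQ_eq_bot (σ : E [⋀^Fin 2]→L[ℝ] ℂ) {k q i : ℕ} (hi : k < 2 * i + q) :
    lefschetzSummandPQ σ k q i = ⊥ := by
  refine le_antisymm (iSup_le fun m ↦ iSup_le fun h ↦ ?_) bot_le
  omega

/-- **The zeroth summand is `P^{p,q}_σ`** (`L⁰ = id`). [cite: Huybrechts1999, §1.7 (arXiv p. 4)] -/
theorem lefschetzSummandPQ_zero (σ : E [⋀^Fin 2]→L[ℝ] ℂ) {k p q : ℕ} (hpq : p + q = k) :
    lefschetzSummandPQ σ k q 0 = primitiveFormsPQ σ k p q := by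
  subst hpq
  rw [lefschetzSummandPQ_eq σ (show 2 * 0 + (p + q) = p + q by omega)]
  ext γ
  simp only [Submodule.mem_map]
  constructor
  · rintro ⟨δ, hδ, rfl⟩
    rw [lefschetzPowC_zero_apply]
    exact hδ
  · intro hγ
    exact ⟨γ, hγ, lefschetzPowC_zero_apply σ _ γ⟩

/-- **The summands shift under `L`**: `lefschetzSummandPQ σ k q (1 + i) = L (lefschetzSummandPQ σ (m+q) q i)` for
`2 + (m + q) = k`. [cite: Huybrechts1999, §1.7 (arXiv p. 4)] -/
theorem lefschetzSummandPQ_one_add (σ : E [⋀^Fin 2]→L[ℝ] ℂ) {m q k : ℕ} (h : 2 * 1 + (m + q) = k) (i : ℕ) :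
    lefschetzSummandPQ σ k q (1 + i) = (lefschetzSummandPQ σ (m + q) q i).map (lefschetzPowC σ 1 h) := by
  by_cases hi : 2 * i ≤ m
  · obtain ⟨j, hj⟩ : ∃ j, 2 * i + j = m := ⟨m - 2 * i, by omega⟩
    rw [lefschetzSummandPQ_eq σ (show 2 * i + (j + q) = m + q by omega),
      lefschetzSummandPQ_eq σ (show 2 * (1 + i) + (j + q) = k by omega), ← Submodule.map_comp]
    congr 1
    refine LinearMap.ext fun γ ↦ ?_
    simp only [LinearMap.comp_apply, lefschetzPowC_lefschetzPowC]
  · rw [lefschetzSummandPQ_eq_bot σ (show k < 2 * (1 + i) + q by omega),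
      lefschetzSummandPQ_eq_bot σ (show m + q < 2 * i + q by omega), Submodule.map_bot]

/-- Each summand lies in `Λ^{p,q}` (`p + q = k`; for `σ` of type `(2,0)`). [cite: Huybrechts1999, §1.7 (arXiv p. 4)] -/
theorem lefschetzSummandPQ_le_typeSubmodule (hσ : IsOfTypeAt 2 0 σ) {k p q : ℕ} (hpq : p + q = k) (i : ℕ) :
    lefschetzSummandPQ σ k q i ≤ typeSubmodule E k p q := by
  refine iSup_le fun m ↦ iSup_le fun h ↦ ?_
  rintro _ ⟨ψ, hψ, rfl⟩
  have hp : 2 * i + m = p := by omega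
  rw [← hp]
  exact lefschetzPowC_mem_typeSubmodule_pq hσ i h rfl hψ.1

/-- `map` of an intersection under a map injective on a set containing both submodules. [folklore] -/
private theorem map_inf_eq_of_injOn' {R M N : Type*} [Semiring R] [AddCommMonoid M] [AddCommMonoid N]
    [Module R M] [Module R N] (f : M →ₗ[R] N) {S A B : Submodule R M} (hS : Set.InjOn f S) (hA : A ≤ S)
    (hB : B ≤ S) : (A ⊓ B).map f = A.map f ⊓ B.map f := by
  refine le_antisymm (Submodule.map_inf_le f) ?_
  rintro y ⟨⟨a, ha, rfl⟩, ⟨b, hb, hab⟩⟩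
  have hba : b = a := hS (hB hb) (hA ha) hab
  subst hba
  exact ⟨b, ⟨ha, hb⟩, rfl⟩

variable [FiniteDimensional ℂ E] (hσ : IsOfTypeAt 2 0 σ) (hnd : ∀ v : E, v ≠ 0 → ∃ w : E, σ ![v, w] ≠ 0)
  {r : ℕ} (hr : 2 * r = finrank ℂ E)

include hσ hnd hr

/-- **The summands span `Λ^{p,q}`** (`p ≤ r`): `Λ^{p,q} = Σᵢ Lⁱ P^{p-2i,q}_σ`, by induction on `p` from the first
step `Λ^{p,q} = P^{p,q}_σ ⊔ L Λ^{p-2,q}`. [cite: Huybrechts1999, §1.7 (arXiv p. 4)] -/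
theorem iSup_lefschetzSummandPQ_eq_typeSubmodule (p : ℕ) : ∀ {k q : ℕ}, p + q = k → p ≤ r →
    ⨆ i, lefschetzSummandPQ σ k q i = typeSubmodule E k p q := by
  induction p using Nat.strong_induction_on with
  | _ p ih =>
  intro k q hpq hp
  refine le_antisymm (iSup_le fun i ↦ lefschetzSummandPQ_le_typeSubmodule hσ hpq i) ?_
  rcases Nat.lt_or_ge p 2 with hp2 | hp2
  · refine le_iSup_of_le 0 ?_
    rw [lefschetzSummandPQ_zero σ hpq, primitiveFormsPQ_eq_typeSubmodule_of_le_one hσ hr hpq (by omega)]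
  · obtain ⟨m, rfl⟩ : ∃ m, p = m + 2 := ⟨p - 2, by omega⟩
    have hm : 2 * 1 + (m + q) = k := by omega
    have ihm := ih m (by omega) (rfl : m + q = m + q) (by omega)
    rw [← primitiveFormsPQ_sup_map_lefschetzPowC hσ hnd hr hm hp]
    refine sup_le (le_iSup_of_le 0 (by rw [lefschetzSummandPQ_zero σ hpq])) ?_
    rw [← ihm, Submodule.map_iSup]
    exact iSup_le fun i ↦ le_iSup_of_le (1 + i) (by rw [lefschetzSummandPQ_one_add σ hm])

/-- **The summands are independent** (`p ≤ r`), by induction on `p`: `P^{p,q}_σ ∩ L Λ^{p-2,q} = 0` and `L` is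
injective on `Λ^{p-2,q}`, so independence in bidegree `(p-2, q)` transports to the summands `L^{1+i} P_σ`.
[cite: Huybrechts1999, §1.7 (arXiv p. 4)] -/
theorem iSupIndep_lefschetzSummandPQ (p : ℕ) : ∀ {k q : ℕ}, p + q = k → p ≤ r →
    iSupIndep (lefschetzSummandPQ σ k q) := by
  induction p using Nat.strong_induction_on with
  | _ p ih =>
  intro k q hpq hp
  rw [iSupIndep_def]
  intro i
  rcases Nat.lt_or_ge p 2 with hp2 | hp2
  · rcases Nat.eq_zero_or_pos i with rfl | hi
    · refine disjoint_bot_right.mono_right (iSup₂_le fun j hj ↦ ?_)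
      rw [lefschetzSummandPQ_eq_bot σ (show k < 2 * j + q by omega)]
    · rw [lefschetzSummandPQ_eq_bot σ (show k < 2 * i + q by omega)]
      exact disjoint_bot_left
  · obtain ⟨m, rfl⟩ : ∃ m, p = m + 2 := ⟨p - 2, by omega⟩
    have hm : 2 * 1 + (m + q) = k := by omega
    have ihm := ih m (by omega) (rfl : m + q = m + q) (by omega)
    have hL : Set.InjOn (lefschetzPowC σ 1 hm) (typeSubmodule E (m + q) m q) :=
      lefschetzPowC_injOn_typeSubmodule_pq hσ hnd hr hm rfl (by omega)
    have hdisj := disjoint_primitiveFormsPQ_map_lefschetzPowC hσ hnd hr hm hp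
    have hle : ∀ i, lefschetzSummandPQ σ k q (1 + i) ≤
        Submodule.map (lefschetzPowC σ 1 hm) (typeSubmodule E (m + q) m q) := fun i ↦ by
      rw [lefschetzSummandPQ_one_add σ hm]
      exact Submodule.map_mono (lefschetzSummandPQ_le_typeSubmodule hσ rfl i)
    rcases Nat.eq_zero_or_pos i with rfl | hi
    · rw [lefschetzSummandPQ_zero σ hpq]
      refine hdisj.mono_right (iSup₂_le fun j hj ↦ ?_)
      obtain ⟨i', rfl⟩ : ∃ i', j = 1 + i' := ⟨j - 1, by omega⟩
      exact hle i'
    · obtain ⟨i, rfl⟩ : ∃ i', i = 1 + i' := ⟨i - 1, by omega⟩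
      rw [Submodule.disjoint_def]
      intro x hx hx'
      have hsplit : (⨆ (j) (_ : j ≠ 1 + i), lefschetzSummandPQ σ k q j) ≤
          lefschetzSummandPQ σ k q 0 ⊔ ⨆ (i') (_ : i' ≠ i), lefschetzSummandPQ σ k q (1 + i') := by
        refine iSup₂_le fun j hj ↦ ?_
        rcases Nat.eq_zero_or_pos j with rfl | hj0
        · exact le_sup_left
        · obtain ⟨i', rfl⟩ : ∃ i', j = 1 + i' := ⟨j - 1, by omega⟩
          exact le_sup_of_le_right (le_iSup₂_of_le i' (fun h ↦ hj (by rw [h])) le_rfl)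
      obtain ⟨y, hy, z, hz, rfl⟩ := Submodule.mem_sup.1 (hsplit hx')
      have hzR : z ∈ Submodule.map (lefschetzPowC σ 1 hm) (typeSubmodule E (m + q) m q) :=
        (iSup₂_le fun i' _ ↦ hle i') hz
      have hyR : y ∈ Submodule.map (lefschetzPowC σ 1 hm) (typeSubmodule E (m + q) m q) := by
        have h1 := Submodule.sub_mem _ (hle i hx) hzR
        rwa [add_sub_cancel_right] at h1
      have hy0 : y = 0 := by
        rw [lefschetzSummandPQ_zero σ hpq] at hy
        exact Submodule.disjoint_def.1 hdisj y hy hyR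
      subst hy0
      rw [zero_add] at hx ⊢
      have hz' : z ∈ (lefschetzSummandPQ σ (m + q) q i ⊓
          ⨆ (i') (_ : i' ≠ i), lefschetzSummandPQ σ (m + q) q i').map (lefschetzPowC σ 1 hm) := by
        rw [map_inf_eq_of_injOn' (lefschetzPowC σ 1 hm) hL (lefschetzSummandPQ_le_typeSubmodule hσ rfl i)
          (iSup₂_le fun i' _ ↦ lefschetzSummandPQ_le_typeSubmodule hσ rfl i'),
          ← lefschetzSummandPQ_one_add σ hm, Submodule.map_iSup]
        refine ⟨hx, ?_⟩
        simp only [Submodule.map_iSup, ← lefschetzSummandPQ_one_add σ hm]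
        exact hz
      rw [(iSupIndep_def.1 ihm i).eq_bot, Submodule.map_bot] at hz'
      exact (Submodule.mem_bot ℂ).1 hz'

/-- **HUYBRECHTS 1999 §1.7 (after Fujiki), the holomorphic Lefschetz decomposition
`H^q(X, Ω^p_X) = ⊕_ℓ L_σ^{p-ℓ} H^q(X, Ω^{2ℓ-p}_X)_σ`, POINTWISE: `Λ^{p,q} = ⊕ᵢ σ^{∧i} ∧ P^{p-2i,q}_σ` for
`p ≤ r` and every `q`** — the summands `lefschetzSummandPQ σ k q i` are independent and span `Λ^{p,q}`
(an internal direct sum of `ℂ`-subspaces of `Altᵏ_ℝ(E; ℂ)`, `k = p + q`), for any non-degenerate `(2,0)`-form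
`σ` on `E` of dimension `2r`. [cite: Huybrechts1999, §1.7 (arXiv p. 4)] -/
theorem iSupIndep_and_iSup_lefschetzSummandPQ {k p q : ℕ} (hpq : p + q = k) (hp : p ≤ r) :
    iSupIndep (lefschetzSummandPQ σ k q) ∧ ⨆ i, lefschetzSummandPQ σ k q i = typeSubmodule E k p q :=
  ⟨iSupIndep_lefschetzSummandPQ hσ hnd hr p hpq hp, iSup_lefschetzSummandPQ_eq_typeSubmodule hσ hnd hr p hpq hp⟩

end Iterated

end HolomorphicSymplectic

/-! ## §6 The hyperkähler structure `σ = ω_J + iω_K` and the torus `X = E/Φ(ℤ^ι)` -/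

section HyperkaehlerTorus

open Literature.Geometry.Kaehler (MForm)
open Literature.Geometry.Kaehler.ComplexTorus (constForm constForm_apply)
open HolomorphicSymplectic

variable {ι : Type*} [Fintype ι] {E : Type*} [NormedAddCommGroup E] [NormedSpace ℂ E]
  [FiniteDimensional ℂ E] (Φ : (ι → ℝ) ≃L[ℝ] E) {σ : E [⋀^Fin 2]→L[ℝ] ℂ}

namespace IsLinearHyperkaehler

/-- **The bidegree Lefschetz decomposition for a linear hyperkähler structure** (`σ = ω_J + iω_K`,
`dim_ℂ E = 2r`): for `p ≤ r` and every `q` the summands `σ^{∧i} ∧ P^{p-2i,q}_σ` are independent and span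
`Λ^{p,q}`. [cite: Huybrechts1999, §1.7 (arXiv p. 4)] -/
theorem iSupIndep_and_iSup_lefschetzSummandPQ {g₀ : E →L[ℝ] E →L[ℝ] ℝ} {J : E →L[ℝ] E}
    (h : IsLinearHyperkaehler g₀ J) {r k p q : ℕ} (hr : 2 * r = finrank ℂ E) (hpq : p + q = k) (hp : p ≤ r) :
    iSupIndep (lefschetzSummandPQ (complexSymplecticForm g₀ J) k q) ∧
      ⨆ i, lefschetzSummandPQ (complexSymplecticForm g₀ J) k q i = typeSubmodule E k p q :=
  HolomorphicSymplectic.iSupIndep_and_iSup_lefschetzSummandPQ h.isOfTypeAt_two_zero_complexSymplecticForm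
    h.nondegenerate_complexSymplecticForm hr hpq hp

end IsLinearHyperkaehler

namespace ComplexTorus

omit [FiniteDimensional ℂ E] in
/-- `constForm` is injective (evaluate at a point of the torus). [folklore] -/
private theorem constForm_injective'' {k : ℕ} {α β : E [⋀^Fin k]→L[ℝ] ℂ}
    (h : constForm Φ α = constForm Φ β) : α = β := by
  have hx := congrFun h (Kaehler.ComplexTorus.proj Φ 0)
  simp only [constForm_apply] at hx
  exact hx

/-- **The holomorphic Lefschetz decomposition on the invariant `(p,q)`-forms of a holomorphic-symplectic
torus** `X = E/Φ(ℤ^ι)` (`dim_ℂ E = 2r`, `σ` an invariant non-degenerate `(2,0)`-form, `2 ≤ p ≤ r`, every `q`):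
every invariant `(p,q)`-form `constForm Φ α` — a Dolbeault representative of `H^q(X, Ω^p_X)` (row A1-09) — is
`constForm Φ α₀ + σ ∧ constForm Φ β` with `α₀` `σ`-PRIMITIVE of type `(p,q)` and `β` of type `(p-2, q)`, and the
pair `(α₀, β)` is unique (Huybrechts' first displayed decomposition, first step, on invariant forms).
[cite: Huybrechts1999, §1.7 (arXiv p. 4)] -/
theorem exists_unique_primitivePQ_add_on_invariantForms (hσ : IsOfTypeAt 2 0 σ)
    (hnd : ∀ v : E, v ≠ 0 → ∃ w : E, σ ![v, w] ≠ 0) {r m q k : ℕ} (hr : 2 * r = finrank ℂ E)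
    (h : 2 * 1 + (m + q) = k) (hk : m + 2 ≤ r) {α : E [⋀^Fin k]→L[ℝ] ℂ} (hα : α ∈ typeSubmodule E k (m + 2) q) :
    ∃ α₀ ∈ primitiveFormsPQ σ k (m + 2) q, ∃ β ∈ typeSubmodule E (m + q) m q,
      constForm Φ α = constForm Φ α₀ + constForm Φ (lefschetzPowC σ 1 h β) ∧
      ∀ α₀' ∈ primitiveFormsPQ σ k (m + 2) q, ∀ β' ∈ typeSubmodule E (m + q) m q,
        constForm Φ α = constForm Φ α₀' + constForm Φ (lefschetzPowC σ 1 h β') → α₀' = α₀ ∧ β' = β := by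
  obtain ⟨α₀, hα₀, β, hβ, hαeq⟩ := exists_mem_primitiveFormsPQ_add_lefschetzPowC hσ hnd hr h hk hα
  refine ⟨α₀, hα₀, β, hβ, ?_, ?_⟩
  · rw [hαeq]; rfl
  · intro α₀' hα₀' β' hβ' heq
    have hpt : α = α₀' + lefschetzPowC σ 1 h β' := constForm_injective'' Φ heq
    rw [hαeq] at hpt
    obtain ⟨h1, h2⟩ := eq_of_primitivePQ_add_lefschetzPowC_eq hσ hnd hr h hk hα₀ hα₀' hβ hβ' hpt
    exact ⟨h1.symm, h2.symm⟩

end ComplexTorus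

end HyperkaehlerTorus

end Literature.Geometry.Hyperkaehler
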